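import Summits.AtomisticToContinuum.HydrodynamicLimit.Theorems.EquilibriumClampedCollisionalWindowLD.Negative.LatticeSep
import Summits.AtomisticToContinuum.HydrodynamicLimit.Theorems.EquilibriumClampedCollisionalWindowLD.Negative.PulseLeftLimits
import Summits.AtomisticToContinuum.HydrodynamicLimit.Theorems.EquilibriumClampedCollisionalWindowLD.Negative.CertificateUniqueness

/-!
# The line lattice: jump times, free flight, left limits, jumps; the flow IS the certificate (helper file of the refutation of `EquilibriumClampedCollisionalWindowLD`, stmt-AtomisticToContinuum-13733; see `Cruxes/EquilibriumClampedCollisionalWindowLD/Disproof.lean` and the evidence WITNESS.md; no Theses declaration is asserted positively; refuter-cdisprove-stmt-AtomisticToContinuum-13733-0)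
-/

noncomputable section

open Real
open scoped InnerProductSpace

namespace Summit.AtomisticToContinuum.HydrodynamicLimit.Theorems

namespace EquilibriumClampedCollisionalWindowLDNegative

section Lattice

open Literature.Analysis.FluidPDE Literature.Analysis.FunctionSpaces
open Filter
open scoped Topology

namespace Lat

variable {Λ : Lat} {N : ℕ} {a : Fin (N + 1) ≃ Λ.Slot}

/-! ### Free flight between jump times, left limits and the jump at a transfer -/

variable (Λ a) in
/-- The jump times of the certificate within the window. [folklore] -/
def jumps (z : Cfg N) : Set ℝ :=
  {c | c ≤ Λ.w ∧ ∃ b, b < Λ.Q ∧ ∃ ℓ : Fin Λ.n × Fin Λ.n, Λ.Active b ∧ c ∈ jumpTimes Λ.P (bv 0) (Λ.bdata a z b ℓ)}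

variable (Λ a) in
/-- The left-limit velocity of sphere `p` at time `c` along the certificate. [folklore] -/
def vLcert (z : Cfg N) (c : ℝ) (p : Fin (N + 1)) : E3 := by
  classical
  exact if Λ.Active (Λ.blk (a p)) then vLft Λ.P (bv 0) (Λ.bdata a z (Λ.blk (a p)) (a p).2) c (Λ.loc (a p))
  else (z p).2

variable (Λ a) in
/-- The left limit of the certificate at time `c`. [folklore] -/
def certL (z : Cfg N) (c : ℝ) : Cfg N := fun p => ((Λ.cert a z c p).1, Λ.vLcert a z c p)

/-- The jump set is finite. [folklore] -/
theorem jumps_finite (z : Cfg N) : (Λ.jumps a z).Finite := by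
  have hfin : (⋃ b ∈ Finset.range Λ.Q, ⋃ ℓ ∈ (Finset.univ : Finset (Fin Λ.n × Fin Λ.n)),
      jumpTimes Λ.P (bv 0) (Λ.bdata a z b ℓ)).Finite :=
    Set.Finite.biUnion (Finset.finite_toSet _) fun b _ =>
      Set.Finite.biUnion (Finset.finite_toSet _) fun ℓ _ => jumpTimes_finite
  refine hfin.subset ?_
  rintro c ⟨-, b, hb, ℓ, -, hc⟩
  simp only [Set.mem_iUnion, Finset.mem_range, Finset.mem_univ, exists_true_left]
  exact ⟨b, hb, ℓ, hc⟩

/-- **Free flight of the certificate** across stretches of the window without jump times. [folklore] -/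
theorem cert_free (hW : Λ.WinOK) {z : Cfg N} (hz : z ∈ Λ.Ev a) {s t : ℝ} (hs0 : 0 ≤ s) (hst : s ≤ t)
    (htw : t ≤ Λ.w) (hC : ∀ c ∈ Λ.jumps a z, c ∉ Set.Ioc s t) :
    Λ.cert a z t = freeFlight (Torus.geometry (Fin 3)) (t - s) (Λ.cert a z s) := by
  classical
  have hΛ := hW.ok
  have hP := hΛ.sep.adm
  funext p
  rw [freeFlight_apply, cert_apply, cert_apply]
  simp only
  rw [translate_proj]
  by_cases hb : Λ.Active (Λ.blk (a p))
  · have hD := dataOK_of_mem hΛ hz hb (a p).2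
    have hwin : t < tHit Λ.P (bv 0) (Λ.bdata a z (Λ.blk (a p)) (a p).2) (Λ.P.K - 1) :=
      lt_of_le_of_lt htw (w_lt_tHit hW hz hb (a p).2)
    have hC' : ∀ c ∈ jumpTimes Λ.P (bv 0) (Λ.bdata a z (Λ.blk (a p)) (a p).2), c ∉ Set.Ioc s t := by
      intro c hc hI
      exact hC c ⟨hI.2.trans htw, Λ.blk (a p), hb.1, (a p).2, hb, hc⟩ hI
    have hff := freeFlight_between hP hD hs0 hst hwin hC' (loc_le_K hΛ (a p))
    rw [liftPos_active z t p hb, liftPos_active z s p hb, certVel_active z t p hb, certVel_active z s p hb,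
      hff.1, hff.2, add_assoc]
  · rw [liftPos_parked z t p hb, liftPos_parked z s p hb, certVel_parked z t p hb, certVel_parked z s p hb]
    congr 1
    rw [sub_smul]; abel_nf

/-- **Left limits of the certificate** at every positive time of the window. [folklore] -/
theorem cert_tendsto (hW : Λ.WinOK) {z : Cfg N} (hz : z ∈ Λ.Ev a) {c : ℝ} (hc0 : 0 < c) (hcw : c ≤ Λ.w) :
    Filter.Tendsto (Λ.cert a z) (𝓝[<] c) (𝓝 (Λ.certL a z c)) := by
  classical
  have hΛ := hW.ok
  have hP := hΛ.sep.adm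
  rw [tendsto_pi_nhds]
  intro p
  show Filter.Tendsto (fun t => Λ.cert a z t p) (𝓝[<] c) (𝓝 (Λ.certL a z c p))
  simp only [certL, cert_apply]
  by_cases hb : Λ.Active (Λ.blk (a p))
  · have hD := dataOK_of_mem hΛ hz hb (a p).2
    have hcw' : c < tHit Λ.P (bv 0) (Λ.bdata a z (Λ.blk (a p)) (a p).2) (Λ.P.K - 1) :=
      lt_of_le_of_lt hcw (w_lt_tHit hW hz hb (a p).2)
    obtain ⟨t₀, ht₀, hwin⟩ := before_any hP hD hc0 hcw'
    have hwin' := hwin (Λ.loc (a p)) (loc_le_K hΛ (a p))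
    set vL := vLft Λ.P (bv 0) (Λ.bdata a z (Λ.blk (a p)) (a p).2) c (Λ.loc (a p)) with hvL
    have hvLcert : Λ.vLcert a z c p = vL := by unfold vLcert; rw [if_pos hb]
    rw [hvLcert]
    -- the affine left approach
    have hev : (fun t => (Torus.proj (Λ.liftPos a z t p), Λ.certVel a z t p)) =ᶠ[𝓝[<] c]
        fun t => (Torus.proj (Λ.liftPos a z c p - (c - t) • vL), vL) := by
      filter_upwards [Ioo_mem_nhdsLT ht₀] with t ht
      obtain ⟨hv, hpos⟩ := hwin' t ht
      rw [certVel_active z t p hb, hv, liftPos_active z t p hb, liftPos_active z c p hb, hpos]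
      congr 2
      abel
    refine Filter.Tendsto.congr' hev.symm ?_
    have hcont : Continuous fun t : ℝ => (Torus.proj (Λ.liftPos a z c p - (c - t) • vL), vL) := by
      refine (Torus.continuous_proj.comp ?_).prodMk continuous_const
      fun_prop
    have := hcont.tendsto c
    simp only [sub_self, zero_smul, sub_zero] at this
    exact this.mono_left nhdsWithin_le_nhds
  · have hvLcert : Λ.vLcert a z c p = (z p).2 := by unfold vLcert; rw [if_neg hb]
    rw [hvLcert]
    have hcont : Continuous fun t : ℝ => (Torus.proj (Λ.liftPos a z t p), Λ.certVel a z t p) := by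
      have h1 : (fun t : ℝ => (Torus.proj (Λ.liftPos a z t p), Λ.certVel a z t p)) =
          fun t => (Torus.proj (Λ.slotVec (a p) + Λ.offset a z p + t • (z p).2), (z p).2) := by
        funext t; rw [liftPos_parked z t p hb, certVel_parked z t p hb]
      rw [h1]
      refine (Torus.continuous_proj.comp ?_).prodMk continuous_const
      fun_prop
    have := hcont.tendsto c
    rw [certVel_parked z c p hb] at this
    exact this.mono_left nhdsWithin_le_nhds

/-- Slot facts of the sphere sitting at block `b`, local index `κ`, line `ℓ`. [folklore] -/
theorem slot_facts (hΛ : Λ.OK) {b κ : ℕ} (hκ : κ < Λ.m) {ℓ : Fin Λ.n × Fin Λ.n} {h : b * Λ.m + κ < Λ.M}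
    {i : Fin (N + 1)} (hi : a i = Λ.slotOf b κ ℓ h) :
    Λ.blk (a i) = b ∧ Λ.loc (a i) = κ ∧ (a i).2 = ℓ := by
  rw [hi]; exact blk_symm_slotOf hΛ hκ ℓ h

/-- **The transferring pair in the chart**: at a transfer time of an active block the separation
vector of the two spheres is `-(ε n)`. [folklore] -/
theorem sepVec_transfer_pair (hW : Λ.WinOK) {z : Cfg N} (hz : z ∈ Λ.Ev a) {b : ℕ} {ℓ : Fin Λ.n × Fin Λ.n}
    (hb : Λ.Active b) {j : ℕ} (hj : j + 2 ≤ Λ.P.K) {c : ℝ}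
    (hc : tHit Λ.P (bv 0) (Λ.bdata a z b ℓ) (j + 1) = c)
    {h1 : b * Λ.m + j < Λ.M} {h2 : b * Λ.m + (j + 1) < Λ.M} {i i' : Fin (N + 1)}
    (hi : a i = Λ.slotOf b j ℓ h1) (hi' : a i' = Λ.slotOf b (j + 1) ℓ h2) :
    (Torus.geometry (Fin 3)).sepVec (Torus.proj (Λ.liftPos a z c i)) (Torus.proj (Λ.liftPos a z c i')) =
      -(Λ.P.ε • nk Λ.P (bv 0) (Λ.bdata a z b ℓ) j) := by
  have hΛ := hW.ok
  have hP := hΛ.sep.adm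
  have hK := hΛ.K_eq
  obtain ⟨hb1, hl1, hL1⟩ := slot_facts hΛ (by omega) hi
  obtain ⟨hb2, hl2, hL2⟩ := slot_facts hΛ (by omega) hi'
  have hsb : Λ.SameBlk a i i' := ⟨hb1 ▸ hb, by rw [hb1, hb2], by rw [hL1, hL2]⟩
  have hdiff := liftPos_sub_sameBlk z c hsb
  rw [hb1, hL1, hl1, hl2] at hdiff
  have hD := dataOK_of_mem hΛ hz hb ℓ
  have hcontact := adj_contact hP hD hj
  rw [hc] at hcontact
  rw [hcontact] at hdiff
  have hsmall : ‖Λ.liftPos a z c i - Λ.liftPos a z c i'‖ < 1 / 2 := by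
    rw [← norm_neg, neg_sub, hdiff, norm_smul, (stepFacts hP hD (by omega : j + 1 ≤ Λ.P.K)).cont.n_unit,
      mul_one, Real.norm_of_nonneg hP.ε_pos.le]
    have := hP.s_le; have := hW.s_le; have := hP.ε_lt_s; linarith
  rw [sepVec_proj_proj hsmall, ← neg_sub, hdiff]

/-- **The jump of the certificate at a transfer time**: left limit, the transferring pair in
contact, and — when that pair is the only one in contact — the elastic reflection. [folklore] -/
theorem cert_jump (hW : Λ.WinOK) {z : Cfg N} (hz : z ∈ Λ.Ev a) {c : ℝ} (hc : c ∈ Λ.jumps a z) :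
    ∃ zl, Filter.Tendsto (Λ.cert a z) (𝓝[<] c) (𝓝 zl) ∧ ∃ i j, i ≠ j ∧
      ‖(Torus.geometry (Fin 3)).sepVec (zl i).1 (zl j).1‖ = Λ.P.ε ∧
      ((∀ i' j', i' ≠ j' → ‖(Torus.geometry (Fin 3)).sepVec (zl i').1 (zl j').1‖ = Λ.P.ε →
          ({i', j'} : Finset (Fin (N + 1))) = {i, j}) →
        Λ.cert a z c = collidePair (Torus.geometry (Fin 3)) i j zl) := by
  classical
  have hΛ := hW.ok
  have hP := hΛ.sep.adm
  have hK := hΛ.K_eq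
  obtain ⟨hcw, b₀, hb₀Q, ℓ₀, hact, hcj⟩ := hc
  obtain ⟨j', hj'1, hj'K, hj'c⟩ := mem_jumpTimes.1 hcj
  obtain ⟨j₀, rfl⟩ : ∃ j₀, j' = j₀ + 1 := ⟨j' - 1, by omega⟩
  have hj₀ : j₀ + 2 ≤ Λ.P.K := by omega
  set D := Λ.bdata a z b₀ ℓ₀ with hDdef
  have hD : DataOK Λ.P (bv 0) D := dataOK_of_mem hΛ hz hact ℓ₀
  have hc0 : 0 < c := by
    rw [← hj'c]
    have := tHit_strictMonoOn hP hD (Nat.succ_pos j₀) (by omega : j₀ + 1 ≤ Λ.P.K)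
    simpa using this
  -- the transferring pair
  have h1 : b₀ * Λ.m + j₀ < Λ.M := blk_slot_lt hΛ hb₀Q (by omega)
  have h2 : b₀ * Λ.m + (j₀ + 1) < Λ.M := blk_slot_lt hΛ hb₀Q (by omega)
  set i := a.symm (Λ.slotOf b₀ j₀ ℓ₀ h1) with hidef
  set j := a.symm (Λ.slotOf b₀ (j₀ + 1) ℓ₀ h2) with hjdef
  have hi : a i = Λ.slotOf b₀ j₀ ℓ₀ h1 := by rw [hidef, Equiv.apply_symm_apply]
  have hj : a j = Λ.slotOf b₀ (j₀ + 1) ℓ₀ h2 := by rw [hjdef, Equiv.apply_symm_apply]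
  obtain ⟨hbi, hli, hLi⟩ := slot_facts hΛ (by omega) hi
  obtain ⟨hbj, hlj, hLj⟩ := slot_facts hΛ (by omega) hj
  have hij : i ≠ j := by
    intro h; have := congrArg (fun r => Λ.loc (a r)) h; simp only [hli, hlj] at this; omega
  have hsv := sepVec_transfer_pair hW hz hact hj₀ hj'c hi hj
  have hn1 : ‖nk Λ.P (bv 0) D j₀‖ = 1 := (stepFacts hP hD (by omega : j₀ + 1 ≤ Λ.P.K)).cont.n_unit
  refine ⟨Λ.certL a z c, cert_tendsto hW hz hc0 hcw, i, j, hij, ?_, ?_⟩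
  · show ‖(Torus.geometry (Fin 3)).sepVec (Λ.cert a z c i).1 (Λ.cert a z c j).1‖ = Λ.P.ε
    rw [cert_fst, cert_fst, hsv, norm_neg, norm_smul, hn1, mul_one, Real.norm_of_nonneg hP.ε_pos.le]
  · intro huniq
    -- every OTHER active block is not at a transfer time
    have hother : ∀ r : Fin (N + 1), Λ.Active (Λ.blk (a r)) → ¬ (Λ.blk (a r) = b₀ ∧ (a r).2 = ℓ₀) →
        ∀ j'', j'' + 2 ≤ Λ.P.K → tHit Λ.P (bv 0) (Λ.bdata a z (Λ.blk (a r)) (a r).2) (j'' + 1) ≠ c := by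
      intro r hr hne j'' hj'' hjc
      have g1 : Λ.blk (a r) * Λ.m + j'' < Λ.M := blk_slot_lt hΛ hr.1 (by omega)
      have g2 : Λ.blk (a r) * Λ.m + (j'' + 1) < Λ.M := blk_slot_lt hΛ hr.1 (by omega)
      set i' := a.symm (Λ.slotOf (Λ.blk (a r)) j'' (a r).2 g1) with hi'def
      set j' := a.symm (Λ.slotOf (Λ.blk (a r)) (j'' + 1) (a r).2 g2) with hj'def
      have hi' : a i' = Λ.slotOf (Λ.blk (a r)) j'' (a r).2 g1 := by rw [hi'def, Equiv.apply_symm_apply]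
      have hj' : a j' = Λ.slotOf (Λ.blk (a r)) (j'' + 1) (a r).2 g2 := by rw [hj'def, Equiv.apply_symm_apply]
      obtain ⟨hbi', hli', hLi'⟩ := slot_facts hΛ (by omega) hi'
      obtain ⟨hbj', hlj', hLj'⟩ := slot_facts hΛ (by omega) hj'
      have hij' : i' ≠ j' := by
        intro h; have := congrArg (fun r => Λ.loc (a r)) h; simp only [hli', hlj'] at this; omega
      have hsv' := sepVec_transfer_pair hW hz hr hj'' hjc hi' hj'
      have hD' := dataOK_of_mem hΛ hz hr (a r).2
      have hcontact' : ‖(Torus.geometry (Fin 3)).sepVec (Λ.certL a z c i').1 (Λ.certL a z c j').1‖ = Λ.P.ε := by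
        show ‖(Torus.geometry (Fin 3)).sepVec (Λ.cert a z c i').1 (Λ.cert a z c j').1‖ = Λ.P.ε
        rw [cert_fst, cert_fst, hsv', norm_neg, norm_smul,
          (stepFacts hP hD' (by omega : j'' + 1 ≤ Λ.P.K)).cont.n_unit, mul_one, Real.norm_of_nonneg hP.ε_pos.le]
      have heq := huniq i' j' hij' hcontact'
      have hi'mem : i' ∈ ({i, j} : Finset (Fin (N + 1))) := by rw [← heq]; simp
      simp only [Finset.mem_insert, Finset.mem_singleton] at hi'mem
      rcases hi'mem with h | h
      · apply hne; rw [← hbi', ← hLi', h, hbi, hLi]; exact ⟨rfl, rfl⟩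
      · apply hne; rw [← hbi', ← hLi', h, hbj, hLj]; exact ⟨rfl, rfl⟩
    -- the left-limit velocities
    have hvi : Λ.vLcert a z c i = (carrier Λ.P (bv 0) D j₀).W := by
      unfold vLcert; rw [if_pos (hbi ▸ hact), hbi, hLi, hli, ← hDdef, vLft_of_jump hP hD hj₀ hj'c, velL_self]
    have hvj : Λ.vLcert a z c j = D.η (j₀ + 1) := by
      unfold vLcert; rw [if_pos (hbj ▸ hact), hbj, hLj, hlj, ← hDdef, vLft_of_jump hP hD hj₀ hj'c, velL_succ]
    have hε0 : Λ.P.ε ≠ 0 := hP.ε_pos.ne'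
    have hrefl := reflectVel_neg_smul_unit hn1 hε0 ((carrier Λ.P (bv 0) D j₀).W) (D.η (j₀ + 1))
    have hck : ck Λ.P (bv 0) D j₀ = ⟪(carrier Λ.P (bv 0) D j₀).W - D.η (j₀ + 1), nk Λ.P (bv 0) D j₀⟫_ℝ := rfl
    have hvel := vel_at_transfer hP hD hj₀
    rw [hj'c] at hvel
    funext r
    by_cases hri : r = i
    · rw [hri, collidePair_apply_left hij, cert_apply]
      show (Torus.proj (Λ.liftPos a z c i), Λ.certVel a z c i) =
        ((Λ.cert a z c i).1, (reflectVel ((Torus.geometry (Fin 3)).sepVec (Λ.cert a z c i).1 (Λ.cert a z c j).1)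
          (Λ.vLcert a z c i, Λ.vLcert a z c j)).1)
      rw [cert_fst, cert_fst, hsv, hvi, hvj, hrefl, certVel_active z c i (hbi ▸ hact), hbi, hLi, hli, ← hDdef,
        hvel.1, hck]
    by_cases hrj : r = j
    · rw [hrj, collidePair_apply_right, cert_apply]
      show (Torus.proj (Λ.liftPos a z c j), Λ.certVel a z c j) =
        ((Λ.cert a z c j).1, (reflectVel ((Torus.geometry (Fin 3)).sepVec (Λ.cert a z c i).1 (Λ.cert a z c j).1)
          (Λ.vLcert a z c i, Λ.vLcert a z c j)).2)
      rw [cert_fst, cert_fst, hsv, hvi, hvj, hrefl, certVel_active z c j (hbj ▸ hact), hbj, hLj, hlj, ← hDdef,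
        hvel.2, hck]
    · rw [collidePair_apply_of_ne hri hrj, cert_apply]
      show (Torus.proj (Λ.liftPos a z c r), Λ.certVel a z c r) = ((Λ.cert a z c r).1, Λ.vLcert a z c r)
      rw [cert_fst]
      congr 1
      by_cases hr : Λ.Active (Λ.blk (a r))
      · rw [certVel_active z c r hr]
        unfold vLcert; rw [if_pos hr]
        by_cases hsame : Λ.blk (a r) = b₀ ∧ (a r).2 = ℓ₀
        · have hne1 : Λ.loc (a r) ≠ j₀ := by
            intro h; apply hri; apply a.injective; rw [hi]
            exact Prod.ext (Fin.ext (show (a r).1.1 = b₀ * Λ.m + j₀ by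
              rw [← Λ.blk_mul_add_loc (a r), hsame.1, h])) hsame.2
          have hne2 : Λ.loc (a r) ≠ j₀ + 1 := by
            intro h; apply hrj; apply a.injective; rw [hj]
            exact Prod.ext (Fin.ext (show (a r).1.1 = b₀ * Λ.m + (j₀ + 1) by
              rw [← Λ.blk_mul_add_loc (a r), hsame.1, h])) hsame.2
          rw [hsame.1, hsame.2, ← hDdef, vLft_of_jump hP hD hj₀ hj'c, velL_of_ne hne1 hne2, hj'c]
        · rw [vLft_of_not_jump (hother r hr hsame)]
      · rw [certVel_parked z c r hr]
        unfold vLcert; rw [if_neg hr]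

/-! ### The flow IS the certificate on the window -/

/-- **Identification of the dynamics**: for a configuration of the labelled event in the good set of
a hard-sphere flow, the flow coincides with the explicit certificate on the whole window. [folklore] -/
theorem flow_eqOn_cert (hW : Λ.WinOK) {z : Cfg N} (hz : z ∈ Λ.Ev a)
    (Φ : HardSphereFlow (Torus.geometry (Fin 3)) Λ.P.ε (N + 1)) (hgood : z ∈ Φ.good) :
    Set.EqOn (fun t => Φ.flow t z) (Λ.cert a z) (Set.Icc 0 Λ.w) := by
  have hΛ := hW.ok
  have hG : ∀ x : UnitAddTorus (Fin 3), Continuous ((Torus.geometry (Fin 3)).translate x) := by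
    intro x
    show Continuous fun v => x + Torus.proj v
    exact continuous_const.add Torus.continuous_proj
  refine Summit.AtomisticToContinuum.HydrodynamicLimit.Theorems.EquilibriumClampedCollisionalWindowLDNegative.eqOn_of_certificate
    (T := Λ.w) hG (Φ.isTrajectory z hgood) (jumps_finite (a := a) z) ?_ ?_ ?_ ?_
  · rw [Φ.flow_zero z hgood, cert_zero hΛ hz]
  · intro s t hs0 hst htw hC
    exact cert_free hW hz hs0 hst htw hC
  · intro t ht htC i j hij
    have h := cert_sep hW hz ht.1 ht.2 hij (fun hsb hjt => htC ⟨ht.2, Λ.blk (a i), hsb.1.1, (a i).2, hsb.1, hjt⟩)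
    exact ne_of_gt h
  · intro c hc
    exact cert_jump hW hz hc

end Lat

end Lattice

end EquilibriumClampedCollisionalWindowLDNegative

end Summit.AtomisticToContinuum.HydrodynamicLimit.Theorems

end
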